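import Literature.Analysis.FluidPDE.SereginSverakPressureMonotone
import HarnessLib

/-!
# One-sided pressure bounds: uniform bounds on the probe energy and on the ball energies of the
# slices (consequences of the monotonicity, in the forms consumed by the endgame)

Analysis/FluidPDE proof file (theorems only; no definitions, no named facts) on the discharge
path of the named fact `Literature.Analysis.FluidPDE.seregin_sverak_2002`
(`SereginSverakPressure.lean`; G. Seregin, V. Šverák, Arch. Ration. Mech. Anal. **163** (2002)
65–86). From the monotonicity of the probe energy
(`SereginSverak2002.scaledEnergy_le_of_oneSided`) and the energy inequality of the Leray–Hopf
class, for a classical Leray–Hopf solution on `[0, T)` with `|u|²/2 + p̃ ≤ K` or `p̃ ≥ -K` on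
`(0, T) × ℝ³` (`K ≥ 0`, any viscosity `ν ≥ 0`) and any probe pair:

* `SereginSverak2002.probeEnergy_le_uniform` — **the probe energy is bounded at all scales
  `0 < s ≤ 1`**: `F(s; x₀, t) ≤ ‖u(0)‖₂² + 4πK` for every centre and every `t ∈ (0, T)`
  (`F(1) ≤ ‖u(t)‖₂² ≤ ‖u(0)‖₂²`, `c_P ≤ 4π/3`);
* `SereginSverak2002.setIntegral_ball_norm_sq_le_uniform` — **the ball energies are Type I**:
  `∫_{B(x₀, ρ)} |u(t)|² ≤ 2(‖u(0)‖₂² + 4πK) ρ` for `0 < ρ ≤ 1/2`.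

These are the bounds `M_F` (tail term `L⁻² F(Lr)`) and `a ∼ M_A r` (Laplacian flux term) of the
window estimate `SereginSverak2002.probeEnergy_sub_le_window`.

## References

* G. Seregin, V. Šverák, Arch. Ration. Mech. Anal. 163 (2002), 65–86 (the result served).
  [SereginSverak2002]
-/

noncomputable section

open _root_.MeasureTheory Set Function Filter _root_.Topology Metric Real
open scoped NNReal ENNReal RealInnerProductSpace ContDiff

namespace Literature.Analysis.FluidPDE

namespace SereginSverak2002

variable {P Pb : ℝ → ℝ}

/-- **Uniform bound on the probe energy at scales `≤ 1`.** For a probe pair, a classical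
Leray–Hopf solution on `[0, T)` (`ν ≥ 0`) with a one-sided pressure bound (`K ≥ 0`), every
centre `x₀`, time `t ∈ (0, T)` and scale `0 < s ≤ 1`:
`∫ |u(t)|² s⁻¹ P̄(|x - x₀|²/s²) ≤ ‖u(0)‖₂² + 4πK`. [folklore] -/
theorem probeEnergy_le_uniform (hP : ContDiff ℝ ∞ P) (hPb : ContDiff ℝ ∞ Pb)
    (hode : ∀ σ, Pb σ + 2 / 3 * σ * deriv Pb σ = P σ) (hP0 : ∀ σ, 1 ≤ σ → P σ = 0)
    (hPnn : ∀ σ, 0 ≤ P σ) (hPle : ∀ σ, P σ ≤ Pb σ) (hPble : ∀ σ, Pb σ ≤ 1)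
    (hPb' : ∀ σ, deriv Pb σ ≤ 0) {ν T : ℝ} (hν : 0 ≤ ν)
    {u : ℝ → EuclideanSpace ℝ (Fin 3) → EuclideanSpace ℝ (Fin 3)}
    {p : ℝ → EuclideanSpace ℝ (Fin 3) → ℝ}
    (hsol : IsClassicalNSSolutionOn (Ico 0 T) ν 0 u p) (hLH : IsLerayHopfOn T ν 0 (u 0) u)
    {K : ℝ} (hK : 0 ≤ K)
    (hone : (∀ t ∈ Ioo 0 T, ∀ x, ‖u t x‖ ^ 2 / 2 + normalisedPressure (u t) x ≤ K) ∨
      (∀ t ∈ Ioo 0 T, ∀ x, -K ≤ normalisedPressure (u t) x))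
    {t : ℝ} (ht : t ∈ Ioo 0 T) (x₀ : EuclideanSpace ℝ (Fin 3)) {s : ℝ} (hs : 0 < s) (hs1 : s ≤ 1) :
    ∫ x, ‖u t x‖ ^ 2 * (s⁻¹ * Pb (‖x - x₀‖ ^ 2 / s ^ 2)) ≤ (∫ x, ‖u 0 x‖ ^ 2) + 4 * π * K := by
  have hPbnn : ∀ σ, 0 ≤ Pb σ := fun σ => (hPnn σ).trans (hPle σ)
  have hw : ContDiff ℝ ∞ (u t) := hsol.contDiff_velocity ⟨ht.1.le, ht.2⟩
  have htI : t ∈ Icc 0 T := ⟨ht.1.le, ht.2.le⟩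
  have hL2 : Integrable fun x => ‖u t x‖ ^ 2 := (hLH.memLp t htI).integrable_norm_pow two_ne_zero
  have hcP := integral_probe_le hP hP0 (fun σ => (hPle σ).trans (hPble σ))
  have hcP0 : 0 ≤ ∫ y : EuclideanSpace ℝ (Fin 3), P (‖y‖ ^ 2) := integral_nonneg fun y => hPnn _
  have hEn := integral_norm_sq_le_of_isLerayHopfOn hν hLH htI
  have hone' : (∀ x ∈ ball x₀ 1, -(2 * K) ≤ normalisedPressure (u t) x) ∨
      (∀ x ∈ ball x₀ 1, ‖u t x‖ ^ 2 + 2 * normalisedPressure (u t) x ≤ 2 * K) := by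
    rcases hone with h | h
    · exact Or.inr fun x _ => by have := h t ht x; linarith
    · exact Or.inl fun x _ => by have := h t ht x; linarith
  have hmono := scaledEnergy_le_of_oneSided hP hPb hode hP0 hPnn hPle hPble hPb' hw hL2 x₀
    (by linarith : 0 ≤ 2 * K) hs hs1 hone'
  -- `F(1) ≤ ∫ |u t|²`
  have hF1 : ∫ x, ‖u t x‖ ^ 2 * ((1 : ℝ)⁻¹ * Pb (‖x - x₀‖ ^ 2 / 1 ^ 2)) ≤ ∫ x, ‖u t x‖ ^ 2 := by
    refine integral_mono ?_ hL2 fun x => ?_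
    · refine (hL2.mul_const 1).mono' ?_ (Eventually.of_forall fun x => ?_)
      · exact ((hw.continuous.norm.pow 2).mul (continuous_const.mul (hPb.continuous.comp
          (((continuous_id.sub continuous_const).norm.pow 2).div_const _)))).aestronglyMeasurable
      · rw [Real.norm_eq_abs, abs_mul, abs_of_nonneg (sq_nonneg _), abs_mul,
          abs_of_nonneg (by positivity), abs_of_nonneg (hPbnn _)]
        exact mul_le_mul_of_nonneg_left (by rw [inv_one, one_mul]; exact hPble _) (sq_nonneg _)
    · calc ‖u t x‖ ^ 2 * ((1 : ℝ)⁻¹ * Pb (‖x - x₀‖ ^ 2 / 1 ^ 2)) ≤ ‖u t x‖ ^ 2 * 1 := by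
            refine mul_le_mul_of_nonneg_left ?_ (sq_nonneg _)
            rw [inv_one, one_mul]; exact hPble _
        _ = ‖u t x‖ ^ 2 := mul_one _
  have hKterm : 3 / 2 * (2 * K) * (∫ y : EuclideanSpace ℝ (Fin 3), P (‖y‖ ^ 2)) * (1 ^ 2 - s ^ 2) ≤
      4 * π * K := by
    have h1 : 3 / 2 * (2 * K) * (∫ y : EuclideanSpace ℝ (Fin 3), P (‖y‖ ^ 2)) ≤
        3 / 2 * (2 * K) * (4 * π / 3) := mul_le_mul_of_nonneg_left hcP (by positivity)
    have h2 : (1 : ℝ) ^ 2 - s ^ 2 ≤ 1 := by nlinarith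
    have h3 : 0 ≤ (1 : ℝ) ^ 2 - s ^ 2 := by nlinarith
    calc 3 / 2 * (2 * K) * (∫ y : EuclideanSpace ℝ (Fin 3), P (‖y‖ ^ 2)) * (1 ^ 2 - s ^ 2)
        ≤ 3 / 2 * (2 * K) * (4 * π / 3) * 1 := mul_le_mul h1 h2 h3 (by positivity)
      _ = 4 * π * K := by ring
  linarith

/-- **Type I for the ball energies of the slices.** Under the same hypotheses, for every centre
`x₀`, time `t ∈ (0, T)` and radius `0 < ρ ≤ 1/2`:
`∫_{B(x₀, ρ)} |u(t)|² ≤ 2 (‖u(0)‖₂² + 4πK) ρ` (the tree's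
`scaledKineticEnergy_le_of_oneSided_pressure'` with `S = 1`, multiplied out). [folklore] -/
theorem setIntegral_ball_norm_sq_le_uniform {ν T : ℝ} (hν : 0 ≤ ν)
    {u : ℝ → EuclideanSpace ℝ (Fin 3) → EuclideanSpace ℝ (Fin 3)}
    {p : ℝ → EuclideanSpace ℝ (Fin 3) → ℝ}
    (hsol : IsClassicalNSSolutionOn (Ico 0 T) ν 0 u p) (hLH : IsLerayHopfOn T ν 0 (u 0) u)
    {K : ℝ} (hK : 0 ≤ K)
    (hone : (∀ t ∈ Ioo 0 T, ∀ x, ‖u t x‖ ^ 2 / 2 + normalisedPressure (u t) x ≤ K) ∨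
      (∀ t ∈ Ioo 0 T, ∀ x, -K ≤ normalisedPressure (u t) x))
    {t : ℝ} (ht : t ∈ Ioo 0 T) (x₀ : EuclideanSpace ℝ (Fin 3)) {ρ : ℝ} (hρ : 0 < ρ)
    (hρ1 : ρ ≤ 1 / 2) :
    ∫ x in ball x₀ ρ, ‖u t x‖ ^ 2 ≤ 2 * ((∫ x, ‖u 0 x‖ ^ 2) + 4 * π * K) * ρ := by
  have h := scaledKineticEnergy_le_of_oneSided_pressure' hν hsol hLH hK hone ht x₀ hρ
    (by linarith : 2 * ρ ≤ 1)
  rw [inv_one, one_mul, one_pow, mul_one] at h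
  have hI0 : 0 ≤ ∫ x in ball x₀ ρ, ‖u t x‖ ^ 2 := integral_nonneg fun x => by positivity
  rw [inv_mul_le_iff₀ hρ] at h
  linarith

end SereginSverak2002

end Literature.Analysis.FluidPDE

end
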